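/-
Copyright (c) 2026 the pub-hodgecm-mathlib formalisation cell (harness21).  Prover seat hodgecm-mathlib-K2Liu-p08 (g2), Track B «K2-LIT»,
#184♮ = hLiu418 = `stmt-HodgeConjecture-24832`; LEAD F0P6-plan (g12) RULING «M-156n» (3) 2026-09-04T08:09:40Z + «=» 08:12:06Z (G7-A), K2E5-plan (g6)
«=» 08:12:41Z; census `K2/K2Liu-p08/g2/CENSUS-G7G8-HeightVsIwasawa.K2Liu-p08-g2.md`.  File G7-A of the «HEIGHT-vs-IWASAWA» organ.
-/
import Mathlib.Algebra.Module.ZLattice.Summable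
import Mathlib.Analysis.Matrix.Order
import Mathlib.Analysis.SpecialFunctions.Pow.Real
import Mathlib.Analysis.Complex.Exponential
import Literature.Analysis.FluidPDE.KochTataruKernel                 -- ★ `one_add_pow_mul_exp_neg_le` : `(1+t)^m e^{−t} ≤ 2^m (1 + m!)`
import HarnessLib

/-!
# Crux `HLiu418`, Road Φ, gap G7-A: LATTICE SUMS WITH EXPONENTIAL DECAY AS A FUNCTION OF THE DECAY RATE, and the positive-cone step

Cell `hodgecm-mathlib`, crux item hLiu418 = `stmt-HodgeConjecture-24832`; LEAD F0P6-plan (g12) (M-156n (3)), co-dealer K2E5-plan (g6).  THEOREMS ONLY (no `def`,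
no instance, no notation, no named-fact hypothesis, no `sorry`); lane `--supports stmt-HodgeConjecture-24832 --as helper` (count-neutral).  PURE MATHLIB.
Consumers: G7-C `K2LiuIwasawaHeightLatticeSumBound` (the face Φ9-CORE consumes), K2E5-p16 (g5)'s Φ6b-5 (H2) `summable_lattice_prod_majorant` (same currency).

THE MATHEMATICS.  ★-to-be (H2) gives `Summable` of the archimedean Whittaker majorant over the lattice of Fourier indices at a FIXED Iwasawa
parameter `g = yyᴴ`; Φ9 needs the value of the sum as a POLYNOMIAL function of `λ_min(g)⁻¹`.  Here:
* §1 (★ `Literature.Analysis.FluidPDE.one_add_pow_mul_exp_neg_le`: `(1+t)^m e^{−t} ≤ 2^m (1 + m!)`) `pow_mul_exp_neg_le_div` — for `0 < ε ≤ 1`: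
  `(1+r)^N e^{−εr} ≤ 2^m(1+m!) / (ε^m (1+r)^b)` with `m = N + b`;
* §2 `summable_inv_one_add_norm_pow` — `Σ_{λ∈Λ} (1+‖λ‖)^{−(d+1)} < ∞` for a discrete `ℤ`-lattice `Λ` of rank `d` (Mathlib `ZLattice.summable_norm_pow_inv`);
  **`exists_tsum_pow_mul_exp_neg_le`** — `∃ C k, ∀ ε ∈ (0,1], Summable ∧ Σ'_{λ∈Λ} (1+‖λ‖)^N e^{−ε‖λ‖} ≤ C / ε^k` (`k = N + d + 1`);
* §3 THE CONE STEP (any size, over `ℂ`): `re_trace_mul_nonneg` — `0 ≤ Re tr(A B)` for `A, B ⪰ 0` (`A = aᴴa`, `tr(aᴴ a B) = tr(a B aᴴ) ≥ 0`);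
  `mul_re_trace_le_re_trace_mul` — `g − ε•1 ⪰ 0 ⇒ ε·Re tr A ≤ Re tr(A g)`;
* §4 2×2 bookkeeping for a positive definite `A` (entries `≤ Re tr A`, `Re det ≥ 0`) and **`exists_tsum_lattice_posDef_prod_le`** — in the (H2) currency
  (`Λ ⊂ S → (Fin 2 → Fin 2 → ℂ)`, Pi sup norm, index `{x : Λ // ∀ σ, (Matrix.of (x σ)).PosDef}`, real exponents `N, N′ ≥ 0`):
  `∃ C k, ∀ ε ∈ (0,1], ∀ g, (∀ σ, (g σ − ε•1).PosSemidef) → Summable ∧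
   Σ' ∏_σ e^{−2π Re tr(x_σ g_σ)} (1 + Re tr x_σ)^N (1 + Re det x_σ)^{−N′} ≤ C / ε^k`.
[Shimura1997, §A3 (lattice sums of exponentials)] [MoeglinWaldspurger1995, I.2.2, II.1.5] — standard estimates; all proofs are Mathlib bookkeeping.
HONEST LABEL.  Count-neutral helper; `HC_CM` is proved only modulo the 7 printed citations (2 remaining named inputs: hLiu418 = `stmt-HodgeConjecture-24832`,
h413 = `stmt-HodgeConjecture-24833`) until rung 0 closes.
-/

set_option autoImplicit false
set_option linter.dupNamespace false -- the mandated namespace repeats `HodgeConjecture.HodgeConjecture`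

noncomputable section

open scoped BigOperators ComplexOrder MatrixOrder Matrix
open Real Finset

namespace Summit.HodgeConjecture.HodgeConjecture.Cruxes.HLiu418.K2LiuLatticeExpDecaySumBound

/-! ## §1 Elementary decay bookkeeping -/

/-- **the pointwise decay bound with parameter**: for `0 < ε ≤ 1`, `r ≥ 0`, `m = N + b`:
`(1+r)^N e^{−εr} ≤ 2^m(1+m!) / (ε^m (1+r)^b)` (`1 + εr ≥ ε(1+r)`). [folklore] -/
theorem pow_mul_exp_neg_le_div (N b : ℕ) {ε r : ℝ} (hε : 0 < ε) (hε1 : ε ≤ 1) (hr : 0 ≤ r) :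
    (1 + r) ^ N * Real.exp (-(ε * r)) ≤ 2 ^ (N + b) * (1 + ((N + b).factorial : ℝ)) / (ε ^ (N + b) * (1 + r) ^ b) := by
  set m := N + b with hm
  have h1r : 0 < 1 + r := by linarith
  have hkey := Literature.Analysis.FluidPDE.one_add_pow_mul_exp_neg_le m (mul_nonneg hε.le hr)
  -- `(ε(1+r))^m ≤ (1+εr)^m`
  have hle : (ε * (1 + r)) ^ m ≤ (1 + ε * r) ^ m :=
    pow_le_pow_left₀ (by positivity) (by nlinarith) m
  have hpos : 0 < ε ^ m * (1 + r) ^ b := by positivity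
  rw [le_div_iff₀ hpos]
  calc (1 + r) ^ N * Real.exp (-(ε * r)) * (ε ^ m * (1 + r) ^ b)
      = (ε * (1 + r)) ^ m * Real.exp (-(ε * r)) := by rw [hm, mul_pow, pow_add]; ring
    _ ≤ (1 + ε * r) ^ m * Real.exp (-(ε * r)) := mul_le_mul_of_nonneg_right hle (Real.exp_pos _).le
    _ ≤ 2 ^ m * (1 + (m.factorial : ℝ)) := hkey

/-! ## §2 Lattice sums -/

section Lattice

variable {V : Type*} [NormedAddCommGroup V] [NormedSpace ℝ V] [FiniteDimensional ℝ V]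
variable (Λ : Submodule ℤ V) [DiscreteTopology Λ] [IsZLattice ℝ Λ]

/-- `Σ_{λ ∈ Λ} ((1+‖λ‖)^{d+1})⁻¹ < ∞`, `d = rank Λ = dim V` (Mathlib `ZLattice.summable_norm_pow_inv`, comparing off `λ = 0`). [folklore] -/
theorem summable_inv_one_add_norm_pow :
    Summable fun x : Λ => ((1 + ‖(x : V)‖) ^ (Module.finrank ℝ V + 1))⁻¹ := by
  have hrank : Module.finrank ℤ Λ < Module.finrank ℝ V + 1 := by rw [ZLattice.rank ℝ Λ]; omega
  have h := ZLattice.summable_norm_pow_inv Λ (Module.finrank ℝ V + 1) hrank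
  refine Summable.of_norm_bounded_eventually h ?_
  refine Filter.eventually_cofinite.mpr ((Set.finite_singleton (0 : Λ)).subset fun z hz => ?_)
  rw [Set.mem_singleton_iff]
  by_contra h0
  apply hz
  have hpos : 0 < ‖z‖ := norm_pos_iff.mpr h0
  have hle : ‖z‖ ≤ 1 + ‖(z : V)‖ := by rw [Submodule.coe_norm]; linarith
  rw [Real.norm_eq_abs, abs_of_nonneg (by positivity), ← inv_pow]
  exact pow_le_pow_left₀ (by positivity) (inv_anti₀ hpos hle) _

/-- **LATTICE SUM WITH EXPONENTIAL DECAY AS A FUNCTION OF THE RATE**: for a full discrete `ℤ`-lattice `Λ ⊂ V` (`dim V = d`) and `N : ℕ` there are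
`C ≥ 0` and `k` (`= N + d + 1`) with, for every `0 < ε ≤ 1`, `Σ'_{λ∈Λ} (1+‖λ‖)^N e^{−ε‖λ‖} ≤ C / ε^k` (and the series is summable).
[cite: Shimura1997, §A3] -/
theorem exists_tsum_pow_mul_exp_neg_le (N : ℕ) :
    ∃ (C : ℝ) (k : ℕ), 0 ≤ C ∧ ∀ ε : ℝ, 0 < ε → ε ≤ 1 →
      Summable (fun x : Λ => (1 + ‖(x : V)‖) ^ N * Real.exp (-(ε * ‖(x : V)‖))) ∧
      ∑' x : Λ, (1 + ‖(x : V)‖) ^ N * Real.exp (-(ε * ‖(x : V)‖)) ≤ C / ε ^ k := by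
  set b := Module.finrank ℝ V + 1 with hb
  set Z : ℝ := ∑' x : Λ, ((1 + ‖(x : V)‖) ^ b)⁻¹ with hZ
  have hZs := summable_inv_one_add_norm_pow Λ
  have hZ0 : 0 ≤ Z := tsum_nonneg fun x => by positivity
  set A : ℝ := 2 ^ (N + b) * (1 + ((N + b).factorial : ℝ)) with hA
  have hA0 : 0 ≤ A := by positivity
  refine ⟨A * Z, N + b, mul_nonneg hA0 hZ0, fun ε hε hε1 => ?_⟩
  -- pointwise domination by `A / ε^m · ((1+‖λ‖)^b)⁻¹`
  have hdom : ∀ x : Λ, (1 + ‖(x : V)‖) ^ N * Real.exp (-(ε * ‖(x : V)‖)) ≤ A / ε ^ (N + b) * ((1 + ‖(x : V)‖) ^ b)⁻¹ := by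
    intro x
    calc (1 + ‖(x : V)‖) ^ N * Real.exp (-(ε * ‖(x : V)‖))
        ≤ 2 ^ (N + b) * (1 + ((N + b).factorial : ℝ)) / (ε ^ (N + b) * (1 + ‖(x : V)‖) ^ b) := pow_mul_exp_neg_le_div N b hε hε1 (norm_nonneg _)
      _ = A / ε ^ (N + b) * ((1 + ‖(x : V)‖) ^ b)⁻¹ := by
          rw [hA, ← div_div, div_eq_mul_inv (2 ^ (N + b) * (1 + ((N + b).factorial : ℝ)) / ε ^ (N + b))]
  have hnn : ∀ x : Λ, 0 ≤ (1 + ‖(x : V)‖) ^ N * Real.exp (-(ε * ‖(x : V)‖)) := fun x => by positivity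
  have hmaj : Summable fun x : Λ => A / ε ^ (N + b) * ((1 + ‖(x : V)‖) ^ b)⁻¹ := hZs.mul_left _
  have hsum : Summable (fun x : Λ => (1 + ‖(x : V)‖) ^ N * Real.exp (-(ε * ‖(x : V)‖))) :=
    Summable.of_nonneg_of_le hnn hdom hmaj
  refine ⟨hsum, ?_⟩
  calc ∑' x : Λ, (1 + ‖(x : V)‖) ^ N * Real.exp (-(ε * ‖(x : V)‖))
      ≤ ∑' x : Λ, A / ε ^ (N + b) * ((1 + ‖(x : V)‖) ^ b)⁻¹ := hsum.tsum_le_tsum hdom hmaj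
    _ = A / ε ^ (N + b) * Z := by rw [hZ, tsum_mul_left]
    _ = A * Z / ε ^ (N + b) := by ring

end Lattice

/-! ## §3 The positive-cone step: traces of products of positive semidefinite matrices -/

section Cone

variable {m : Type*} [Fintype m] [DecidableEq m]

/-- **`0 ≤ Re tr(A B)` for `A, B ⪰ 0`** (`A = aᴴ a`, `tr(aᴴ a B) = tr(a B aᴴ)`, and `a B aᴴ ⪰ 0`). [folklore] -/
theorem re_trace_mul_nonneg {A B : Matrix m m ℂ} (hA : A.PosSemidef) (hB : B.PosSemidef) : 0 ≤ ((A * B).trace).re := by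
  obtain ⟨a, rfl⟩ := CStarAlgebra.nonneg_iff_eq_star_mul_self.mp hA.nonneg
  have h1 : (star a * a * B).trace = (a * B * aᴴ).trace := by
    rw [Matrix.star_eq_conjTranspose, Matrix.mul_assoc, Matrix.trace_mul_comm]
  have h2 : (a * B * aᴴ).PosSemidef := hB.mul_mul_conjTranspose_same a
  have h3 : (0 : ℂ) ≤ (a * B * aᴴ).trace := h2.trace_nonneg
  rw [h1]
  exact (Complex.nonneg_iff.1 h3).1

/-- **the cone step**: `A ⪰ 0` and `g − ε•1 ⪰ 0` imply `ε · Re tr A ≤ Re tr(A g)`. [folklore] -/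
theorem mul_re_trace_le_re_trace_mul {A g : Matrix m m ℂ} (hA : A.PosSemidef) {ε : ℝ}
    (hg : (g - (ε : ℂ) • (1 : Matrix m m ℂ)).PosSemidef) : ε * (A.trace).re ≤ ((A * g).trace).re := by
  have hsplit : A * g = A * (g - (ε : ℂ) • (1 : Matrix m m ℂ)) + (ε : ℂ) • A := by
    rw [Matrix.mul_sub, Matrix.mul_smul, Matrix.mul_one, sub_add_cancel]
  have h0 := re_trace_mul_nonneg hA hg
  rw [hsplit, Matrix.trace_add, Matrix.trace_smul, Complex.add_re, smul_eq_mul, Complex.re_ofReal_mul]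
  linarith

end Cone

/-! ## §4 The (H2)-currency corollary: sums over the positive-definite part of a lattice in `∏_σ Herm₂(ℂ)` -/

section TwoByTwo

/-- 2×2 positive definite bookkeeping: diagonal entries are nonnegative reals, the off-diagonal ones are bounded by the trace, and
`Re a₀₀ · Re a₁₁ − |a₀₁|² ≥ 0`. [folklore] -/
theorem posDef_two_entries {A : Matrix (Fin 2) (Fin 2) ℂ} (hA : A.PosDef) :
    0 ≤ (A 0 0).re ∧ 0 ≤ (A 1 1).re ∧ (A 0 0).im = 0 ∧ (A 1 1).im = 0 ∧
      (∀ i j : Fin 2, ‖A i j‖ ≤ (A 0 0).re + (A 1 1).re) ∧ 0 ≤ (A 0 0).re * (A 1 1).re - Complex.normSq (A 0 1) := by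
  have hH := hA.isHermitian
  have h00 : (0 : ℂ) ≤ A 0 0 := hA.posSemidef.diag_nonneg
  have h11 : (0 : ℂ) ≤ A 1 1 := hA.posSemidef.diag_nonneg
  obtain ⟨h00r, h00i⟩ := Complex.nonneg_iff.1 h00
  obtain ⟨h11r, h11i⟩ := Complex.nonneg_iff.1 h11
  have h10 : A 1 0 = (starRingEnd ℂ) (A 0 1) := by
    have := hH.apply 1 0
    rw [← this]
    rfl
  -- the determinant
  have hdet : (0 : ℂ) < A.det := hA.det_pos
  have hdet' : A.det = A 0 0 * A 1 1 - A 0 1 * A 1 0 := Matrix.det_fin_two A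
  have hdetre : (A.det).re = (A 0 0).re * (A 1 1).re - Complex.normSq (A 0 1) := by
    rw [hdet', Complex.sub_re, Complex.mul_re, ← h00i, ← h11i, h10, Complex.mul_conj, Complex.ofReal_re]
    ring
  have hdetpos : 0 < (A 0 0).re * (A 1 1).re - Complex.normSq (A 0 1) := by
    rw [← hdetre]; exact (Complex.pos_iff.1 hdet).1
  -- norms of the entries
  have hn00 : ‖A 0 0‖ = (A 0 0).re := by
    rw [← Complex.re_add_im (A 0 0), ← h00i]; simp [abs_of_nonneg h00r]
  have hn11 : ‖A 1 1‖ = (A 1 1).re := by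
    rw [← Complex.re_add_im (A 1 1), ← h11i]; simp [abs_of_nonneg h11r]
  have hn01 : ‖A 0 1‖ ≤ (A 0 0).re + (A 1 1).re := by
    have hsq : ‖A 0 1‖ ^ 2 < ((A 0 0).re + (A 1 1).re) ^ 2 := by
      rw [Complex.sq_norm]
      nlinarith [mul_nonneg h00r h11r]
    exact (lt_of_pow_lt_pow_left₀ 2 (by positivity) hsq).le
  have hn10 : ‖A 1 0‖ ≤ (A 0 0).re + (A 1 1).re := by
    rw [h10, Complex.norm_conj]; exact hn01
  refine ⟨h00r, h11r, h00i.symm, h11i.symm, fun i j => ?_, hdetpos.le⟩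
  fin_cases i <;> fin_cases j
  · simp only [Fin.zero_eta, Fin.isValue]; rw [hn00]; linarith
  · exact hn01
  · exact hn10
  · simp only [Fin.mk_one, Fin.isValue]; rw [hn11]; linarith

variable {S : Type*} [Fintype S]

/-- sup-norm bookkeeping on `V = S → (Fin 2 → Fin 2 → ℂ)`: if every entry of every component is `≤ T σ` with `T ≥ 0`, then `‖x‖ ≤ Σ_σ T σ`. [folklore] -/
theorem pi_norm_le_sum {x : S → (Fin 2 → Fin 2 → ℂ)} {T : S → ℝ} (hT : ∀ σ, 0 ≤ T σ) (h : ∀ σ i j, ‖x σ i j‖ ≤ T σ) :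
    ‖x‖ ≤ ∑ σ, T σ := by
  have hsum : 0 ≤ ∑ σ, T σ := Finset.sum_nonneg fun σ _ => hT σ
  refine (pi_norm_le_iff_of_nonneg hsum).2 fun σ => ?_
  refine (pi_norm_le_iff_of_nonneg hsum).2 fun i => ?_
  refine (pi_norm_le_iff_of_nonneg hsum).2 fun j => ?_
  exact (h σ i j).trans (Finset.single_le_sum (fun σ' _ => hT σ') (Finset.mem_univ σ))

/-- an entry is bounded by the sup norm. [folklore] -/
theorem norm_apply_le_pi_norm (x : S → (Fin 2 → Fin 2 → ℂ)) (σ : S) (i j : Fin 2) : ‖x σ i j‖ ≤ ‖x‖ :=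
  ((norm_le_pi_norm (x σ i) j).trans (norm_le_pi_norm (x σ) i)).trans (norm_le_pi_norm x σ)

/-- **THE POINTWISE COMPARISON** behind the (H2)-currency bound: for `v : S → (Fin 2 → Fin 2 → ℂ)` with every `Matrix.of (v σ)` positive definite,
`g_σ − ε•1 ⪰ 0` (`ε > 0`), real exponents `N, N′ ≥ 0` and `N · |S| ≤ Nn`, the (H2) summand is nonnegative and
`≤ (2^N)^{|S|} · (1+‖v‖)^{Nn} e^{−ε‖v‖}`. [cite: MoeglinWaldspurger1995, II.1.5] [cite: Shimura1997, §A3] -/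
theorem prod_summand_le {N N' : ℝ} (hN : 0 ≤ N) (hN' : 0 ≤ N') {Nn : ℕ} (hNn : N * Fintype.card S ≤ Nn)
    {ε : ℝ} (hε : 0 < ε) {g : S → Matrix (Fin 2) (Fin 2) ℂ} (hg : ∀ σ, (g σ - (ε : ℂ) • (1 : Matrix (Fin 2) (Fin 2) ℂ)).PosSemidef)
    {v : S → (Fin 2 → Fin 2 → ℂ)} (hv : ∀ σ, (Matrix.of (v σ)).PosDef) :
    0 ≤ ∏ σ, (Real.exp (-(2 * Real.pi * ((Matrix.of (v σ) * g σ).trace).re)) * (1 + ((v σ 0 0).re + (v σ 1 1).re)) ^ N *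
        (1 + ((v σ 0 0).re * (v σ 1 1).re - Complex.normSq (v σ 0 1))) ^ (-N')) ∧
    ∏ σ, (Real.exp (-(2 * Real.pi * ((Matrix.of (v σ) * g σ).trace).re)) * (1 + ((v σ 0 0).re + (v σ 1 1).re)) ^ N *
        (1 + ((v σ 0 0).re * (v σ 1 1).re - Complex.normSq (v σ 0 1))) ^ (-N')) ≤
      ((2 : ℝ) ^ N) ^ Fintype.card S * ((1 + ‖v‖) ^ Nn * Real.exp (-(ε * ‖v‖))) := by
  -- per-place data
  have hE : ∀ σ, 0 ≤ (v σ 0 0).re ∧ 0 ≤ (v σ 1 1).re ∧ (v σ 0 0).im = 0 ∧ (v σ 1 1).im = 0 ∧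
      (∀ i j : Fin 2, ‖v σ i j‖ ≤ (v σ 0 0).re + (v σ 1 1).re) ∧ 0 ≤ (v σ 0 0).re * (v σ 1 1).re - Complex.normSq (v σ 0 1) :=
    fun σ => posDef_two_entries (hv σ)
  have hT0 : ∀ σ, 0 ≤ (v σ 0 0).re + (v σ 1 1).re := fun σ => add_nonneg (hE σ).1 (hE σ).2.1
  -- `‖v‖ ≤ Σ T` and `T σ ≤ 2‖v‖`
  have hnorm : ‖v‖ ≤ ∑ σ, ((v σ 0 0).re + (v σ 1 1).re) := pi_norm_le_sum hT0 fun σ i j => (hE σ).2.2.2.2.1 i j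
  have hTle : ∀ σ, (v σ 0 0).re + (v σ 1 1).re ≤ 2 * ‖v‖ := fun σ =>
    calc (v σ 0 0).re + (v σ 1 1).re ≤ ‖v σ 0 0‖ + ‖v σ 1 1‖ := add_le_add (Complex.re_le_norm _) (Complex.re_le_norm _)
      _ ≤ ‖v‖ + ‖v‖ := add_le_add (norm_apply_le_pi_norm v σ 0 0) (norm_apply_le_pi_norm v σ 1 1)
      _ = 2 * ‖v‖ := by ring
  -- the trace of `Matrix.of (v σ)` and the cone step
  have htr : ∀ σ, ((Matrix.of (v σ)).trace).re = (v σ 0 0).re + (v σ 1 1).re := fun σ => by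
    rw [Matrix.trace_fin_two, Complex.add_re]; rfl
  have hcone : ∀ σ, ε * ((v σ 0 0).re + (v σ 1 1).re) ≤ ((Matrix.of (v σ) * g σ).trace).re := fun σ => by
    rw [← htr σ]; exact mul_re_trace_le_re_trace_mul (hv σ).posSemidef (hg σ)
  -- the three factors, per place
  have hexp : ∀ σ, Real.exp (-(2 * Real.pi * ((Matrix.of (v σ) * g σ).trace).re)) ≤ Real.exp (-(ε * ((v σ 0 0).re + (v σ 1 1).re))) :=
    fun σ => by
    apply Real.exp_le_exp.2
    have hπ : 1 ≤ 2 * Real.pi := by linarith [Real.two_le_pi]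
    have h1 : ε * ((v σ 0 0).re + (v σ 1 1).re) ≤ 2 * Real.pi * (ε * ((v σ 0 0).re + (v σ 1 1).re)) :=
      le_mul_of_one_le_left (mul_nonneg hε.le (hT0 σ)) hπ
    nlinarith [hcone σ]
  have hpowN : ∀ σ, (1 + ((v σ 0 0).re + (v σ 1 1).re)) ^ N ≤ (2 : ℝ) ^ N * (1 + ‖v‖) ^ N := fun σ => by
    rw [← Real.mul_rpow (by norm_num) (by positivity)]
    exact Real.rpow_le_rpow (by linarith [hT0 σ]) (by linarith [hTle σ, norm_nonneg v]) hN
  have hdetfac : ∀ σ, (1 + ((v σ 0 0).re * (v σ 1 1).re - Complex.normSq (v σ 0 1))) ^ (-N') ≤ 1 := fun σ =>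
    Real.rpow_le_one_of_one_le_of_nonpos (by linarith [(hE σ).2.2.2.2.2]) (by linarith)
  have hfac0 : ∀ σ, 0 ≤ Real.exp (-(2 * Real.pi * ((Matrix.of (v σ) * g σ).trace).re)) * (1 + ((v σ 0 0).re + (v σ 1 1).re)) ^ N *
      (1 + ((v σ 0 0).re * (v σ 1 1).re - Complex.normSq (v σ 0 1))) ^ (-N') := fun σ =>
    mul_nonneg (mul_nonneg (Real.exp_pos _).le (Real.rpow_nonneg (by linarith [hT0 σ]) _))
      (Real.rpow_nonneg (by linarith [(hE σ).2.2.2.2.2]) _)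
  have hprod : ∏ σ, (Real.exp (-(2 * Real.pi * ((Matrix.of (v σ) * g σ).trace).re)) * (1 + ((v σ 0 0).re + (v σ 1 1).re)) ^ N *
        (1 + ((v σ 0 0).re * (v σ 1 1).re - Complex.normSq (v σ 0 1))) ^ (-N')) ≤
      ∏ σ, Real.exp (-(ε * ((v σ 0 0).re + (v σ 1 1).re))) * ((2 : ℝ) ^ N * (1 + ‖v‖) ^ N) := by
    refine Finset.prod_le_prod (fun σ _ => hfac0 σ) fun σ _ => ?_
    calc Real.exp (-(2 * Real.pi * ((Matrix.of (v σ) * g σ).trace).re)) * (1 + ((v σ 0 0).re + (v σ 1 1).re)) ^ N *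
          (1 + ((v σ 0 0).re * (v σ 1 1).re - Complex.normSq (v σ 0 1))) ^ (-N')
        ≤ Real.exp (-(ε * ((v σ 0 0).re + (v σ 1 1).re))) * ((2 : ℝ) ^ N * (1 + ‖v‖) ^ N) * 1 :=
          mul_le_mul (mul_le_mul (hexp σ) (hpowN σ) (Real.rpow_nonneg (by linarith [hT0 σ]) _) (Real.exp_pos _).le)
            (hdetfac σ) (Real.rpow_nonneg (by linarith [(hE σ).2.2.2.2.2]) _) (by positivity)
      _ = Real.exp (-(ε * ((v σ 0 0).re + (v σ 1 1).re))) * ((2 : ℝ) ^ N * (1 + ‖v‖) ^ N) := mul_one _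
  -- evaluate the product
  have hprod' : ∏ σ, Real.exp (-(ε * ((v σ 0 0).re + (v σ 1 1).re))) * ((2 : ℝ) ^ N * (1 + ‖v‖) ^ N) =
      Real.exp (-(ε * ∑ σ, ((v σ 0 0).re + (v σ 1 1).re))) * (((2 : ℝ) ^ N) ^ Fintype.card S * ((1 + ‖v‖) ^ N) ^ Fintype.card S) := by
    rw [Finset.prod_mul_distrib, ← Real.exp_sum, Finset.prod_const, Finset.card_univ, mul_pow, Finset.mul_sum, ← Finset.sum_neg_distrib]
  -- compare with the natural-exponent majorant
  have h1v : 1 ≤ 1 + ‖v‖ := by linarith [norm_nonneg v]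
  have hrpow : ((1 + ‖v‖) ^ N) ^ Fintype.card S ≤ (1 + ‖v‖) ^ Nn := by
    rw [← Real.rpow_natCast ((1 + ‖v‖) ^ N), ← Real.rpow_mul (by positivity), ← Real.rpow_natCast (1 + ‖v‖) Nn]
    exact Real.rpow_le_rpow_of_exponent_le h1v hNn
  have hexp' : Real.exp (-(ε * ∑ σ, ((v σ 0 0).re + (v σ 1 1).re))) ≤ Real.exp (-(ε * ‖v‖)) := by
    apply Real.exp_le_exp.2
    nlinarith [hnorm, hε.le]
  have hK0 : 0 ≤ ((2 : ℝ) ^ N) ^ Fintype.card S := by positivity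
  refine ⟨Finset.prod_nonneg fun σ _ => hfac0 σ, ?_⟩
  calc ∏ σ, (Real.exp (-(2 * Real.pi * ((Matrix.of (v σ) * g σ).trace).re)) * (1 + ((v σ 0 0).re + (v σ 1 1).re)) ^ N *
        (1 + ((v σ 0 0).re * (v σ 1 1).re - Complex.normSq (v σ 0 1))) ^ (-N'))
      ≤ ∏ σ, Real.exp (-(ε * ((v σ 0 0).re + (v σ 1 1).re))) * ((2 : ℝ) ^ N * (1 + ‖v‖) ^ N) := hprod
    _ = Real.exp (-(ε * ∑ σ, ((v σ 0 0).re + (v σ 1 1).re))) * (((2 : ℝ) ^ N) ^ Fintype.card S * ((1 + ‖v‖) ^ N) ^ Fintype.card S) := hprod'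
    _ ≤ Real.exp (-(ε * ‖v‖)) * (((2 : ℝ) ^ N) ^ Fintype.card S * (1 + ‖v‖) ^ Nn) :=
        mul_le_mul hexp' (mul_le_mul_of_nonneg_left hrpow hK0) (by positivity) (Real.exp_pos _).le
    _ = ((2 : ℝ) ^ N) ^ Fintype.card S * ((1 + ‖v‖) ^ Nn * Real.exp (-(ε * ‖v‖))) := by ring

variable (Λ : Submodule ℤ (S → (Fin 2 → Fin 2 → ℂ))) [DiscreteTopology Λ] [IsZLattice ℝ Λ]

/-- **THE (H2)-CURRENCY LATTICE BOUND WITH PARAMETER.**  `Λ ⊂ ∏_σ Herm₂(ℂ)` a full discrete `ℤ`-lattice (in `S → (Fin 2 → Fin 2 → ℂ)`, Pi sup norm),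
real exponents `N, N′ ≥ 0`: there are `C ≥ 0`, `k` such that for every `0 < ε ≤ 1` and every `g : S → M₂(ℂ)` with `g_σ − ε•1 ⪰ 0` for all `σ`,
the series over the positive-definite lattice points `Σ' ∏_σ e^{−2π Re tr(x_σ g_σ)} (1 + Re tr x_σ)^N (1 + Re det x_σ)^{−N′}` is summable and `≤ C / ε^k`
(the summand of K2E5-p16's Φ6b-5 (H2), trace and determinant spelled through the entries).  [cite: Shimura1997, §A3] [cite: MoeglinWaldspurger1995, II.1.5] -/
theorem exists_tsum_lattice_posDef_prod_le {N N' : ℝ} (hN : 0 ≤ N) (hN' : 0 ≤ N') :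
    ∃ (C : ℝ) (k : ℕ), 0 ≤ C ∧ ∀ ε : ℝ, 0 < ε → ε ≤ 1 → ∀ g : S → Matrix (Fin 2) (Fin 2) ℂ,
      (∀ σ, (g σ - (ε : ℂ) • (1 : Matrix (Fin 2) (Fin 2) ℂ)).PosSemidef) →
      Summable (fun x : {x : Λ // ∀ σ, (Matrix.of ((x : S → (Fin 2 → Fin 2 → ℂ)) σ)).PosDef} =>
        ∏ σ, (Real.exp (-(2 * Real.pi * ((Matrix.of (((x : Λ) : S → (Fin 2 → Fin 2 → ℂ)) σ) * g σ).trace).re)) *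
          (1 + ((((x : Λ) : S → (Fin 2 → Fin 2 → ℂ)) σ 0 0).re + (((x : Λ) : S → (Fin 2 → Fin 2 → ℂ)) σ 1 1).re)) ^ N *
          (1 + ((((x : Λ) : S → (Fin 2 → Fin 2 → ℂ)) σ 0 0).re * (((x : Λ) : S → (Fin 2 → Fin 2 → ℂ)) σ 1 1).re -
            Complex.normSq ((((x : Λ) : S → (Fin 2 → Fin 2 → ℂ)) σ 0 1)))) ^ (-N'))) ∧
      ∑' x : {x : Λ // ∀ σ, (Matrix.of ((x : S → (Fin 2 → Fin 2 → ℂ)) σ)).PosDef},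
        ∏ σ, (Real.exp (-(2 * Real.pi * ((Matrix.of (((x : Λ) : S → (Fin 2 → Fin 2 → ℂ)) σ) * g σ).trace).re)) *
          (1 + ((((x : Λ) : S → (Fin 2 → Fin 2 → ℂ)) σ 0 0).re + (((x : Λ) : S → (Fin 2 → Fin 2 → ℂ)) σ 1 1).re)) ^ N *
          (1 + ((((x : Λ) : S → (Fin 2 → Fin 2 → ℂ)) σ 0 0).re * (((x : Λ) : S → (Fin 2 → Fin 2 → ℂ)) σ 1 1).re -
            Complex.normSq ((((x : Λ) : S → (Fin 2 → Fin 2 → ℂ)) σ 0 1)))) ^ (-N')) ≤ C / ε ^ k := by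
  classical
  -- the comparison lattice sum with natural exponent `Nn ≥ N · |S|`
  obtain ⟨C₀, k, hC₀, hmain⟩ := exists_tsum_pow_mul_exp_neg_le Λ (⌈N⌉₊ * Fintype.card S)
  have hNn : N * Fintype.card S ≤ ((⌈N⌉₊ * Fintype.card S : ℕ) : ℝ) := by
    rw [Nat.cast_mul]
    exact mul_le_mul_of_nonneg_right (Nat.le_ceil N) (Nat.cast_nonneg _)
  have hK0 : 0 ≤ ((2 : ℝ) ^ N) ^ Fintype.card S := by positivity
  refine ⟨((2 : ℝ) ^ N) ^ Fintype.card S * C₀, k, mul_nonneg hK0 hC₀, fun ε hε hε1 g hg => ?_⟩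
  obtain ⟨hsum0, hle0⟩ := hmain ε hε hε1
  have hcmp := fun x : {x : Λ // ∀ σ, (Matrix.of ((x : S → (Fin 2 → Fin 2 → ℂ)) σ)).PosDef} =>
    prod_summand_le hN hN' hNn hε hg x.2
  have hFs : Summable fun x : {x : Λ // ∀ σ, (Matrix.of ((x : S → (Fin 2 → Fin 2 → ℂ)) σ)).PosDef} =>
      ((2 : ℝ) ^ N) ^ Fintype.card S * ((1 + ‖((x : Λ) : S → (Fin 2 → Fin 2 → ℂ))‖) ^ (⌈N⌉₊ * Fintype.card S) *
        Real.exp (-(ε * ‖((x : Λ) : S → (Fin 2 → Fin 2 → ℂ))‖))) := (hsum0.mul_left _).subtype _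
  have hfs := Summable.of_nonneg_of_le (fun x => (hcmp x).1) (fun x => (hcmp x).2) hFs
  refine ⟨hfs, ?_⟩
  have hF0 : ∀ x : Λ, 0 ≤ ((2 : ℝ) ^ N) ^ Fintype.card S * ((1 + ‖(x : S → (Fin 2 → Fin 2 → ℂ))‖) ^ (⌈N⌉₊ * Fintype.card S) *
      Real.exp (-(ε * ‖(x : S → (Fin 2 → Fin 2 → ℂ))‖))) := fun x => by positivity
  calc _ ≤ ∑' x : {x : Λ // ∀ σ, (Matrix.of ((x : S → (Fin 2 → Fin 2 → ℂ)) σ)).PosDef},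
        ((2 : ℝ) ^ N) ^ Fintype.card S * ((1 + ‖((x : Λ) : S → (Fin 2 → Fin 2 → ℂ))‖) ^ (⌈N⌉₊ * Fintype.card S) *
          Real.exp (-(ε * ‖((x : Λ) : S → (Fin 2 → Fin 2 → ℂ))‖))) := hfs.tsum_le_tsum (fun x => (hcmp x).2) hFs
    _ ≤ ∑' x : Λ, ((2 : ℝ) ^ N) ^ Fintype.card S * ((1 + ‖(x : S → (Fin 2 → Fin 2 → ℂ))‖) ^ (⌈N⌉₊ * Fintype.card S) *
          Real.exp (-(ε * ‖(x : S → (Fin 2 → Fin 2 → ℂ))‖))) :=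
        tsum_comp_le_tsum_of_inj (hsum0.mul_left _) hF0 Subtype.val_injective
    _ = ((2 : ℝ) ^ N) ^ Fintype.card S * ∑' x : Λ, (1 + ‖(x : S → (Fin 2 → Fin 2 → ℂ))‖) ^ (⌈N⌉₊ * Fintype.card S) *
          Real.exp (-(ε * ‖(x : S → (Fin 2 → Fin 2 → ℂ))‖)) := tsum_mul_left
    _ ≤ ((2 : ℝ) ^ N) ^ Fintype.card S * (C₀ / ε ^ k) := mul_le_mul_of_nonneg_left hle0 hK0
    _ = ((2 : ℝ) ^ N) ^ Fintype.card S * C₀ / ε ^ k := by ring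

end TwoByTwo

end Summit.HodgeConjecture.HodgeConjecture.Cruxes.HLiu418.K2LiuLatticeExpDecaySumBound

end
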